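import Mathlib
import HarnessLib

/-!
# An algebra with an anticommuting pair `i² = a`, `j² = b`: `dim E = 4 · dim C_E(i, j)`, and for an anti-involution `τ`
# with `τ i = -i`, `τ j = -j`: `dim E⁻ = dim C⁻ + 3 · dim C⁺`

Topic `Literature/Algebra/Lie`.  Theorems only (no definition, no named fact), Mathlib vocabulary (`Subalgebra.centralizer`,
`LinearMap.mulLeft/mulRight`, kernels).  Written for the cell `pub-hodgecm2` (COR-CM), seat `b27` (count-neutral
Mumford–Tate-rank lane), as the algebra of the TYPE-III count: for a simple complex abelian variety whose endomorphism
algebra is a totally definite quaternion algebra `D = (a, b / ℚ)`, the Rosati involution is the canonical involution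
(`ī = -i`, `j̄ = -j`), the Hodge Lie algebra lies in the Lefschetz Lie algebra `C_{End V}(D) ∩ 𝔰𝔭(V, φ)` (Moonen–Zarhin 1999
§1 «`Hg(X) ⊂ Sp_D(V, φ)`»), and Milne 1999 §2 (type III; Summary table) gives its dimension `g²/2 - g/2` (`F = ℚ`).

SETTING: `E` a finite-dimensional algebra over a field `K` with `2 ≠ 0`; `i, j ∈ E`, `i² = a`, `j² = b` (`a, b ∈ K×`),
`ij = -ji`; `C = C_E(i, j)`; `τ : E → E` linear with `τ(xy) = τ(y)τ(x)`, `τ² = 1`, `τ(i) = -i`, `τ(j) = -j`;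
`E^± = ker(τ ∓ 1)`, `C^± = C ∩ E^±`.  RESULTS (namespace `Literature.Algebra.Lie.QuaternionCentralizer`):
* **`finrank_eq_four_mul_finrank_centralizer`** — `dim E = 4 dim C` (Voight Prop. 7.7.8 (b) `dim B = dim A · dim C_B(A)`
  for the quaternion subalgebra `A = K⟨i, j⟩`, here by the elementary Klein-four decomposition: the four simultaneous
  (anti)commutation spaces of `i, j` exhaust `E` (`x = ½(x + c⁻¹uxu) + ½(x - c⁻¹uxu)`, `u² = c`) and are isomorphic under
  left multiplication by `i` and `j`);
* **`finrank_centralizer_eq_add`** — `dim C = dim C⁺ + dim C⁻`;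
* **`finrank_skew_eq_add_three_mul`** — `dim E⁻ = dim C⁻ + 3 dim C⁺` (for `x ∈ C_E(u)`, `τ(ux) = -u τ(x)`: on `iC`, `jC`,
  `ijC` the skew part is a copy of `C⁺`);
* **`eight_mul_finrank_centralizer_skew_add`** — `8 dim C⁻ + 4 dim E⁻ = 3 dim E`.  With `E = End V`, `dim V = d`, `τ` the
  adjoint of a symplectic form (`dim E⁻ = d(d+1)/2`, `Literature/Algebra/Lie/SymplecticAlgebraDimension`):
  `dim C⁻ = d(d-2)/8` (`= g²/2 - g/2`, `d = 2g`; `= 6` for `d = 8`, used in `CorCM/MumfordTateRankSevenTypeThreeConverse`).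

## References
* [Voight2021] J. Voight, *Quaternion Algebras*, GTM 288 (2021), Prop. 7.7.8 (b).
* [Milne1999LefschetzClasses] J. S. Milne, *Lefschetz classes on abelian varieties*, Duke Math. J. 96 (1999), §2 (simple
  abelian variety of type III; Summary table `dim = g²/2f - g/2`).
* [MoonenZarhin1999LowDim] B. Moonen, Yu. Zarhin, Math. Ann. 315 (1999), §1 (`Hg(X) ⊂ Sp_D(V, φ)`).
-/

namespace Literature.Algebra.Lie

namespace QuaternionCentralizer

open Module

variable {K : Type*} [Field K] {E : Type*} [Ring E] [Algebra K E]

/-! ### Membership in the (anti)commutation spaces and in the `τ`-eigenspaces -/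

/-- `x ∈ ker(L_u - R_u)` iff `ux = xu`. [cite: Voight2021, Prop. 7.7.8 (b)] -/
theorem mem_ker_sub_iff (u x : E) :
    x ∈ LinearMap.ker (LinearMap.mulLeft K u - LinearMap.mulRight K u) ↔ u * x = x * u := by
  rw [LinearMap.mem_ker, LinearMap.sub_apply, LinearMap.mulLeft_apply, LinearMap.mulRight_apply, sub_eq_zero]

/-- `x ∈ ker(L_u + R_u)` iff `ux = -xu`. [cite: Voight2021, Prop. 7.7.8 (b)] -/
theorem mem_ker_add_iff (u x : E) :
    x ∈ LinearMap.ker (LinearMap.mulLeft K u + LinearMap.mulRight K u) ↔ u * x = -(x * u) := by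
  rw [LinearMap.mem_ker, LinearMap.add_apply, LinearMap.mulLeft_apply, LinearMap.mulRight_apply, add_eq_zero_iff_eq_neg]

/-- `x ∈ ker(τ - 1)` iff `τ x = x`. [cite: Milne1999LefschetzClasses, §2 (type III)] -/
theorem mem_ker_sub_id_iff (τ : E →ₗ[K] E) (x : E) : x ∈ LinearMap.ker (τ - LinearMap.id) ↔ τ x = x := by
  rw [LinearMap.mem_ker, LinearMap.sub_apply, LinearMap.id_apply, sub_eq_zero]

/-- `x ∈ ker(τ + 1)` iff `τ x = -x`. [cite: Milne1999LefschetzClasses, §2 (type III)] -/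
theorem mem_ker_add_id_iff (τ : E →ₗ[K] E) (x : E) : x ∈ LinearMap.ker (τ + LinearMap.id) ↔ τ x = -x := by
  rw [LinearMap.mem_ker, LinearMap.add_apply, LinearMap.id_apply, add_eq_zero_iff_eq_neg]

/-- The centralizer of `{i, j}` is `ker(L_i - R_i) ∩ ker(L_j - R_j)`. [cite: Voight2021, Prop. 7.7.8 (b)] -/
theorem toSubmodule_centralizer_pair (i j : E) :
    Subalgebra.toSubmodule (Subalgebra.centralizer K ({i, j} : Set E)) =
      LinearMap.ker (LinearMap.mulLeft K i - LinearMap.mulRight K i) ⊓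
        LinearMap.ker (LinearMap.mulLeft K j - LinearMap.mulRight K j) := by
  ext x
  rw [Subalgebra.mem_toSubmodule, Subalgebra.mem_centralizer_iff, Submodule.mem_inf, mem_ker_sub_iff, mem_ker_sub_iff]
  simp only [Set.mem_insert_iff, Set.mem_singleton_iff, forall_eq_or_imp, forall_eq]

/-! ### Left multiplication by `u` with `u² = c ≠ 0` -/

/-- `u (u y) = c • y` for `u² = c`. [cite: Voight2021, Prop. 7.7.8 (b)] -/
theorem mul_mul_eq_smul {u : E} {c : K} (hu : u * u = algebraMap K E c) (y : E) : u * (u * y) = c • y := by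
  rw [← mul_assoc, hu, Algebra.smul_def]

/-- `(y u) u = c • y` for `u² = c`. [cite: Voight2021, Prop. 7.7.8 (b)] -/
theorem mul_mul_eq_smul' {u : E} {c : K} (hu : u * u = algebraMap K E c) (y : E) : y * u * u = c • y := by
  rw [mul_assoc, hu, ← Algebra.commutes, Algebra.smul_def]

/-- Left multiplication by `u` with `u² = c ≠ 0` is injective. [cite: Voight2021, Prop. 7.7.8 (b)] -/
theorem mulLeft_injective {u : E} {c : K} (hc : c ≠ 0) (hu : u * u = algebraMap K E c) :
    Function.Injective (LinearMap.mulLeft K u) := by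
  intro x y hxy
  have h : u * x = u * y := by simpa only [LinearMap.mulLeft_apply] using hxy
  have h2 : c • x = c • y := by rw [← mul_mul_eq_smul hu, ← mul_mul_eq_smul hu, h]
  simpa only [inv_smul_smul₀ hc] using congrArg (fun z => c⁻¹ • z) h2

variable [FiniteDimensional K E]

/-- **Transport by `L_u`**: if `u² = c ≠ 0`, `uS ⊆ T` and `uT ⊆ S` then `dim S = dim T`. [cite: Voight2021, Prop. 7.7.8 (b)] -/
theorem finrank_eq_of_mul_mem {u : E} {c : K} (hc : c ≠ 0) (hu : u * u = algebraMap K E c) {S T : Submodule K E}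
    (hST : ∀ x ∈ S, u * x ∈ T) (hTS : ∀ x ∈ T, u * x ∈ S) : finrank K S = finrank K T := by
  have key : ∀ {S T : Submodule K E}, (∀ x ∈ S, u * x ∈ T) → finrank K S ≤ finrank K T := by
    intro S T hST
    have hf : ∀ x ∈ S, LinearMap.mulLeft K u x ∈ T := fun x hx => by
      rw [LinearMap.mulLeft_apply]; exact hST x hx
    refine LinearMap.finrank_le_finrank_of_injective (f := (LinearMap.mulLeft K u).restrict hf) fun x y hxy => ?_
    apply Subtype.ext
    apply mulLeft_injective hc hu
    have h := congrArg Subtype.val hxy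
    simpa only [LinearMap.restrict_apply] using h
  exact le_antisymm (key hST) (key hTS)

variable [NeZero (2 : K)]

/-- **Splitting a `τ`-stable subspace along a linear involution `τ`**: `dim S = dim (S ∩ ker(τ-1)) + dim (S ∩ ker(τ+1))`
(`x = ½(x + τx) + ½(x - τx)`, `2 ≠ 0`). [cite: Milne1999LefschetzClasses, §2 (type III)] -/
theorem finrank_eq_add_of_involutive (τ : E →ₗ[K] E) (hττ : ∀ x, τ (τ x) = x) {S : Submodule K E}
    (hS : ∀ x ∈ S, τ x ∈ S) :
    finrank K S = finrank K ↥(S ⊓ LinearMap.ker (τ - LinearMap.id)) +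
      finrank K ↥(S ⊓ LinearMap.ker (τ + LinearMap.id)) := by
  have h2 : (2 : K) ≠ 0 := two_ne_zero
  set A := S ⊓ LinearMap.ker (τ - LinearMap.id)
  set B := S ⊓ LinearMap.ker (τ + LinearMap.id)
  have hAB : A ⊓ B = ⊥ := by
    rw [Submodule.eq_bot_iff]
    intro x hx
    rw [Submodule.mem_inf, Submodule.mem_inf, Submodule.mem_inf] at hx
    obtain ⟨⟨-, hx1⟩, -, hx2⟩ := hx
    rw [mem_ker_sub_id_iff] at hx1
    rw [mem_ker_add_id_iff] at hx2
    have h : (2 : K) • x = 0 := by rw [two_smul]; nth_rw 1 [← hx1]; rw [hx2, neg_add_cancel]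
    simpa only [inv_smul_smul₀ h2, smul_zero] using congrArg (fun z => (2 : K)⁻¹ • z) h
  have hsup : A ⊔ B = S := by
    refine le_antisymm (sup_le inf_le_left inf_le_left) fun x hx => ?_
    have hx' : x = (2 : K)⁻¹ • (x + τ x) + (2 : K)⁻¹ • (x - τ x) := by
      rw [← smul_add, add_add_sub_cancel, ← two_smul K x, inv_smul_smul₀ h2]
    rw [hx']
    refine Submodule.add_mem_sup (Submodule.smul_mem _ _ (Submodule.mem_inf.2 ⟨S.add_mem hx (hS x hx), ?_⟩))
      (Submodule.smul_mem _ _ (Submodule.mem_inf.2 ⟨S.sub_mem hx (hS x hx), ?_⟩))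
    · rw [mem_ker_sub_id_iff, map_add, hττ, add_comm]
    · rw [mem_ker_add_id_iff, map_sub, hττ, neg_sub]
  have h := Submodule.finrank_sup_add_finrank_inf_eq A B
  rw [hsup, hAB, finrank_bot, add_zero] at h
  exact h

/-- **Splitting a conjugation-stable subspace along `u`** (`u² = c ≠ 0`): if `u x u ∈ S` for `x ∈ S` then
`dim S = dim (S ∩ ker(L_u - R_u)) + dim (S ∩ ker(L_u + R_u))` (`x = ½(x + c⁻¹uxu) + ½(x - c⁻¹uxu)`).
[cite: Voight2021, Prop. 7.7.8 (b)] -/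
theorem finrank_eq_add_of_conj_mem {u : E} {c : K} (hc : c ≠ 0) (hu : u * u = algebraMap K E c) {S : Submodule K E}
    (hS : ∀ x ∈ S, u * x * u ∈ S) :
    finrank K S = finrank K ↥(S ⊓ LinearMap.ker (LinearMap.mulLeft K u - LinearMap.mulRight K u)) +
      finrank K ↥(S ⊓ LinearMap.ker (LinearMap.mulLeft K u + LinearMap.mulRight K u)) := by
  -- the conjugation `σ x = c⁻¹ • u x u` is a linear involution with the two kernels as `±1`-eigenspaces
  let σ : E →ₗ[K] E := c⁻¹ • (LinearMap.mulLeft K u * LinearMap.mulRight K u)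
  have hσ : ∀ x, σ x = c⁻¹ • (u * (x * u)) := fun x => rfl
  have hσσ : ∀ x, σ (σ x) = x := fun x => by
    rw [hσ, hσ, smul_mul_assoc, mul_smul_comm, ← mul_assoc u (u * (x * u)) u, mul_mul_eq_smul hu, smul_mul_assoc,
      mul_mul_eq_smul' hu, inv_smul_smul₀ hc, inv_smul_smul₀ hc]
  have hplus : LinearMap.ker (σ - LinearMap.id) = LinearMap.ker (LinearMap.mulLeft K u - LinearMap.mulRight K u) := by
    ext x
    rw [mem_ker_sub_id_iff, mem_ker_sub_iff, hσ]
    constructor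
    · intro h
      calc u * x = u * (c⁻¹ • (u * (x * u))) := by rw [h]
        _ = x * u := by rw [mul_smul_comm, mul_mul_eq_smul hu, inv_smul_smul₀ hc]
    · intro h
      rw [← h, mul_mul_eq_smul hu, inv_smul_smul₀ hc]
  have hminus : LinearMap.ker (σ + LinearMap.id) = LinearMap.ker (LinearMap.mulLeft K u + LinearMap.mulRight K u) := by
    ext x
    rw [mem_ker_add_id_iff, mem_ker_add_iff, hσ]
    constructor
    · intro h
      have h1 : u * (-x) = x * u := by rw [← h, mul_smul_comm, mul_mul_eq_smul hu, inv_smul_smul₀ hc]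
      rw [mul_neg] at h1
      rw [← h1, neg_neg]
    · intro h
      have h' : x * u = -(u * x) := by rw [h, neg_neg]
      rw [h', mul_neg, mul_mul_eq_smul hu, smul_neg, inv_smul_smul₀ hc]
  have hSσ : ∀ x ∈ S, σ x ∈ S := fun x hx => by
    rw [hσ, ← mul_assoc]
    exact S.smul_mem _ (hS x hx)
  rw [← hplus, ← hminus]
  exact finrank_eq_add_of_involutive σ hσσ hSσ

/-! ### Elementary (anti)commutation transport -/

section Transport

omit [FiniteDimensional K E] [NeZero (2 : K)]

/-- `ux = xu ⟹ u(ux) = (ux)u`. [folklore] -/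
private theorem cen_self {u x : E} (h : u * x = x * u) : u * (u * x) = u * x * u := by
  calc u * (u * x) = u * (x * u) := by rw [h]
    _ = u * x * u := (mul_assoc _ _ _).symm

/-- `ux = -xu ⟹ u(ux) = -(ux)u`. [folklore] -/
private theorem anti_self {u x : E} (h : u * x = -(x * u)) : u * (u * x) = -(u * x * u) := by
  calc u * (u * x) = u * (-(x * u)) := by rw [h]
    _ = -(u * x * u) := by rw [mul_neg, ← mul_assoc]

/-- `uv = -vu`, `vx = xv ⟹ v(ux) = -(ux)v`. [folklore] -/
private theorem anti_of_cen {u v x : E} (huv : u * v = -(v * u)) (h : v * x = x * v) : v * (u * x) = -(u * x * v) := by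
  have hvu : v * u = -(u * v) := by rw [huv, neg_neg]
  calc v * (u * x) = v * u * x := (mul_assoc _ _ _).symm
    _ = -(u * (v * x)) := by rw [hvu, neg_mul, mul_assoc]
    _ = -(u * x * v) := by rw [h, ← mul_assoc]

/-- `uv = -vu`, `vx = -xv ⟹ v(ux) = (ux)v`. [folklore] -/
private theorem cen_of_anti {u v x : E} (huv : u * v = -(v * u)) (h : v * x = -(x * v)) : v * (u * x) = u * x * v := by
  have hvu : v * u = -(u * v) := by rw [huv, neg_neg]
  calc v * (u * x) = v * u * x := (mul_assoc _ _ _).symm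
    _ = -(u * (v * x)) := by rw [hvu, neg_mul, mul_assoc]
    _ = u * x * v := by rw [h, mul_neg, neg_neg, ← mul_assoc]

/-- `uv = -vu`, `ux = xu ⟹ u(vxv) = (vxv)u`. [folklore] -/
private theorem conj_cen {u v x : E} (huv : u * v = -(v * u)) (h : u * x = x * u) :
    u * (v * x * v) = v * x * v * u := by
  have hvu : v * u = -(u * v) := by rw [huv, neg_neg]
  calc u * (v * x * v) = u * v * x * v := by simp only [mul_assoc]
    _ = -(v * (u * x) * v) := by rw [huv]; simp only [neg_mul, mul_assoc]
    _ = -(v * x * (u * v)) := by rw [h]; simp only [mul_assoc]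
    _ = v * x * v * u := by rw [huv]; simp only [mul_neg, neg_neg, mul_assoc]

/-- `uv = -vu`, `ux = -xu ⟹ u(vxv) = -(vxv)u`. [folklore] -/
private theorem conj_anti {u v x : E} (huv : u * v = -(v * u)) (h : u * x = -(x * u)) :
    u * (v * x * v) = -(v * x * v * u) := by
  calc u * (v * x * v) = u * v * x * v := by simp only [mul_assoc]
    _ = -(v * (u * x) * v) := by rw [huv]; simp only [neg_mul, mul_assoc]
    _ = v * x * (u * v) := by rw [h]; simp only [mul_neg, neg_mul, neg_neg, mul_assoc]
    _ = -(v * x * v * u) := by rw [huv]; simp only [mul_neg, mul_assoc]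

variable (τ : E →ₗ[K] E)

/-- `τ(ux) = -τ(x)u` for an anti-homomorphism `τ` with `τu = -u`. [folklore] -/
private theorem tau_mul (hτm : ∀ x y, τ (x * y) = τ y * τ x) {u : E} (hτu : τ u = -u) (x : E) :
    τ (u * x) = -(τ x * u) := by
  rw [hτm, hτu, mul_neg]

/-- `ux = xu ⟹ u τ(x) = τ(x) u` (`τ` anti-homomorphism, `τu = -u`). [folklore] -/
private theorem tau_cen (hτm : ∀ x y, τ (x * y) = τ y * τ x) {u : E} (hτu : τ u = -u) {x : E} (h : u * x = x * u) :
    u * τ x = τ x * u := by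
  have h' := congrArg τ h
  rw [hτm, hτm, hτu, neg_mul, mul_neg, neg_inj] at h'
  exact h'.symm

/-- `ux = -xu ⟹ u τ(x) = -τ(x) u` (`τ` anti-homomorphism, `τu = -u`). [folklore] -/
private theorem tau_anti (hτm : ∀ x y, τ (x * y) = τ y * τ x) {u : E} (hτu : τ u = -u) {x : E}
    (h : u * x = -(x * u)) : u * τ x = -(τ x * u) := by
  have h' := congrArg τ h
  rw [map_neg, hτm, hτm, hτu, neg_mul, mul_neg, neg_neg] at h'
  rw [← h']

/-- `τx = -x ⟹ τ(uxu) = -(uxu)` (`τ` anti-homomorphism, `τu = -u`). [folklore] -/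
private theorem tau_conj (hτm : ∀ x y, τ (x * y) = τ y * τ x) {u : E} (hτu : τ u = -u) {x : E} (h : τ x = -x) :
    τ (u * x * u) = -(u * x * u) := by
  rw [hτm, hτm, hτu, h]
  simp only [neg_mul, mul_neg, neg_neg, mul_assoc]

end Transport

/-! ### The count -/

/-- **`dim E = 4 · dim (Cᵢ ∩ Cⱼ)`** (kernel form, `Cᵤ = ker(Lᵤ - Rᵤ)`): the four simultaneous (anti)commutation spaces of
`i, j` exhaust `E` and are isomorphic under left multiplication by `i`, `j` — the dimension statement of
`E ≅ K⟨i,j⟩ ⊗ C_E(i,j)` (Voight Prop. 7.7.8 (b) for the quaternion subalgebra). [cite: Voight2021, Prop. 7.7.8 (b)] -/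
theorem finrank_eq_four_mul_finrank_ker {i j : E} {a b : K} (ha : a ≠ 0) (hb : b ≠ 0) (hi : i * i = algebraMap K E a)
    (hj : j * j = algebraMap K E b) (hij : i * j = -(j * i)) :
    finrank K E = 4 * finrank K ↥(LinearMap.ker (LinearMap.mulLeft K i - LinearMap.mulRight K i) ⊓
        LinearMap.ker (LinearMap.mulLeft K j - LinearMap.mulRight K j)) := by
  set Ci := LinearMap.ker (LinearMap.mulLeft K i - LinearMap.mulRight K i) with hCi
  set Ai := LinearMap.ker (LinearMap.mulLeft K i + LinearMap.mulRight K i) with hAi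
  set Cj := LinearMap.ker (LinearMap.mulLeft K j - LinearMap.mulRight K j) with hCj
  set Aj := LinearMap.ker (LinearMap.mulLeft K j + LinearMap.mulRight K j) with hAj
  have hji : j * i = -(i * j) := by rw [hij, neg_neg]
  have hE : finrank K E = finrank K Ci + finrank K Ai := by
    have h := finrank_eq_add_of_conj_mem ha hi (S := ⊤) (fun x _ => Submodule.mem_top)
    rw [finrank_top, top_inf_eq, top_inf_eq] at h
    exact h
  have hCi' : finrank K Ci = finrank K ↥(Ci ⊓ Cj) + finrank K ↥(Ci ⊓ Aj) := by
    refine finrank_eq_add_of_conj_mem hb hj fun x hx => ?_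
    simp only [hCi, mem_ker_sub_iff] at hx ⊢
    exact conj_cen hij hx
  have hAi' : finrank K Ai = finrank K ↥(Ai ⊓ Cj) + finrank K ↥(Ai ⊓ Aj) := by
    refine finrank_eq_add_of_conj_mem hb hj fun x hx => ?_
    simp only [hAi, mem_ker_add_iff] at hx ⊢
    exact conj_anti hij hx
  have e1 : finrank K ↥(Ci ⊓ Cj) = finrank K ↥(Ci ⊓ Aj) := by
    refine finrank_eq_of_mul_mem ha hi (fun x hx => ?_) (fun x hx => ?_)
    · simp only [hCi, hCj, hAj, Submodule.mem_inf, mem_ker_sub_iff, mem_ker_add_iff] at hx ⊢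
      exact ⟨cen_self hx.1, anti_of_cen hij hx.2⟩
    · simp only [hCi, hCj, hAj, Submodule.mem_inf, mem_ker_sub_iff, mem_ker_add_iff] at hx ⊢
      exact ⟨cen_self hx.1, cen_of_anti hij hx.2⟩
  have e2 : finrank K ↥(Ai ⊓ Cj) = finrank K ↥(Ai ⊓ Aj) := by
    refine finrank_eq_of_mul_mem ha hi (fun x hx => ?_) (fun x hx => ?_)
    · simp only [hAi, hCj, hAj, Submodule.mem_inf, mem_ker_add_iff, mem_ker_sub_iff] at hx ⊢
      exact ⟨anti_self hx.1, anti_of_cen hij hx.2⟩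
    · simp only [hAi, hCj, hAj, Submodule.mem_inf, mem_ker_add_iff, mem_ker_sub_iff] at hx ⊢
      exact ⟨anti_self hx.1, cen_of_anti hij hx.2⟩
  have e3 : finrank K ↥(Ci ⊓ Cj) = finrank K ↥(Ai ⊓ Cj) := by
    refine finrank_eq_of_mul_mem hb hj (fun x hx => ?_) (fun x hx => ?_)
    · simp only [hCi, hCj, hAi, Submodule.mem_inf, mem_ker_sub_iff, mem_ker_add_iff] at hx ⊢
      exact ⟨anti_of_cen hji hx.1, cen_self hx.2⟩
    · simp only [hCi, hCj, hAi, Submodule.mem_inf, mem_ker_sub_iff, mem_ker_add_iff] at hx ⊢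
      exact ⟨cen_of_anti hji hx.1, cen_self hx.2⟩
  omega

/-- **The `τ`-splitting of `Cᵢ ∩ Cⱼ` and of `E⁻`** (kernel form): for a linear anti-involution `τ` with `τ i = -i`,
`τ j = -j`: `dim (Cᵢ ∩ Cⱼ) = dim (Cᵢ ∩ Cⱼ ∩ E⁺) + dim (Cᵢ ∩ Cⱼ ∩ E⁻)` and
`dim E⁻ = dim (Cᵢ ∩ Cⱼ ∩ E⁻) + 3 dim (Cᵢ ∩ Cⱼ ∩ E⁺)` (`E^± = ker(τ ∓ 1)`): on `iC`, `jC`, `ijC` the skew part for `τ`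
is a copy of `C⁺` — the count behind Milne's `dim = g²/2 - g/2` for the type-III Lefschetz group.
[cite: Milne1999LefschetzClasses, §2 (type III) and Summary] [cite: Voight2021, Prop. 7.7.8 (b)] -/
theorem finrank_ker_counts {i j : E} {a b : K} (ha : a ≠ 0) (hb : b ≠ 0) (hi : i * i = algebraMap K E a)
    (hj : j * j = algebraMap K E b) (hij : i * j = -(j * i)) (τ : E →ₗ[K] E)
    (hτm : ∀ x y, τ (x * y) = τ y * τ x) (hττ : ∀ x, τ (τ x) = x) (hτi : τ i = -i) (hτj : τ j = -j) :
    finrank K ↥(LinearMap.ker (LinearMap.mulLeft K i - LinearMap.mulRight K i) ⊓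
          LinearMap.ker (LinearMap.mulLeft K j - LinearMap.mulRight K j)) =
        finrank K ↥(LinearMap.ker (LinearMap.mulLeft K i - LinearMap.mulRight K i) ⊓
            LinearMap.ker (LinearMap.mulLeft K j - LinearMap.mulRight K j) ⊓ LinearMap.ker (τ - LinearMap.id)) +
          finrank K ↥(LinearMap.ker (LinearMap.mulLeft K i - LinearMap.mulRight K i) ⊓
            LinearMap.ker (LinearMap.mulLeft K j - LinearMap.mulRight K j) ⊓ LinearMap.ker (τ + LinearMap.id)) ∧
      finrank K ↥(LinearMap.ker (τ + LinearMap.id)) =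
        finrank K ↥(LinearMap.ker (LinearMap.mulLeft K i - LinearMap.mulRight K i) ⊓
            LinearMap.ker (LinearMap.mulLeft K j - LinearMap.mulRight K j) ⊓ LinearMap.ker (τ + LinearMap.id)) +
          3 * finrank K ↥(LinearMap.ker (LinearMap.mulLeft K i - LinearMap.mulRight K i) ⊓
            LinearMap.ker (LinearMap.mulLeft K j - LinearMap.mulRight K j) ⊓ LinearMap.ker (τ - LinearMap.id)) := by
  set Ci := LinearMap.ker (LinearMap.mulLeft K i - LinearMap.mulRight K i) with hCi
  set Ai := LinearMap.ker (LinearMap.mulLeft K i + LinearMap.mulRight K i) with hAi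
  set Cj := LinearMap.ker (LinearMap.mulLeft K j - LinearMap.mulRight K j) with hCj
  set Aj := LinearMap.ker (LinearMap.mulLeft K j + LinearMap.mulRight K j) with hAj
  set Ep := LinearMap.ker (τ - LinearMap.id) with hEp
  set Em := LinearMap.ker (τ + LinearMap.id) with hEm
  have hji : j * i = -(i * j) := by rw [hij, neg_neg]
  have hτim := tau_mul τ hτm hτi
  have hτjm := tau_mul τ hτm hτj
  -- `C = C⁺ ⊕ C⁻`
  have hC : finrank K ↥(Ci ⊓ Cj) = finrank K ↥(Ci ⊓ Cj ⊓ Ep) + finrank K ↥(Ci ⊓ Cj ⊓ Em) := by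
    refine finrank_eq_add_of_involutive τ hττ fun x hx => ?_
    simp only [hCi, hCj, Submodule.mem_inf, mem_ker_sub_iff] at hx ⊢
    exact ⟨tau_cen τ hτm hτi hx.1, tau_cen τ hτm hτj hx.2⟩
  -- the skew part
  have hEm' : finrank K Em = finrank K ↥(Em ⊓ Ci) + finrank K ↥(Em ⊓ Ai) := by
    refine finrank_eq_add_of_conj_mem ha hi fun x hx => ?_
    simp only [hEm, mem_ker_add_id_iff] at hx ⊢
    exact tau_conj τ hτm hτi hx
  have hEmCi : finrank K ↥(Em ⊓ Ci) = finrank K ↥(Em ⊓ Ci ⊓ Cj) + finrank K ↥(Em ⊓ Ci ⊓ Aj) := by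
    refine finrank_eq_add_of_conj_mem hb hj fun x hx => ?_
    simp only [hEm, hCi, Submodule.mem_inf, mem_ker_add_id_iff, mem_ker_sub_iff] at hx ⊢
    exact ⟨tau_conj τ hτm hτj hx.1, conj_cen hij hx.2⟩
  have hEmAi : finrank K ↥(Em ⊓ Ai) = finrank K ↥(Em ⊓ Ai ⊓ Cj) + finrank K ↥(Em ⊓ Ai ⊓ Aj) := by
    refine finrank_eq_add_of_conj_mem hb hj fun x hx => ?_
    simp only [hEm, hAi, Submodule.mem_inf, mem_ker_add_id_iff, mem_ker_add_iff] at hx ⊢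
    exact ⟨tau_conj τ hτm hτj hx.1, conj_anti hij hx.2⟩
  have f1 : finrank K ↥(Em ⊓ Ci ⊓ Aj) = finrank K ↥(Ci ⊓ Cj ⊓ Ep) := by
    refine finrank_eq_of_mul_mem ha hi (fun x hx => ?_) (fun x hx => ?_)
    · simp only [hEm, hCi, hAj, hCj, hEp, Submodule.mem_inf, mem_ker_add_id_iff, mem_ker_sub_iff, mem_ker_add_iff,
        mem_ker_sub_id_iff] at hx ⊢
      obtain ⟨⟨hτx, hxi⟩, hxj⟩ := hx
      refine ⟨⟨cen_self hxi, cen_of_anti hij hxj⟩, ?_⟩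
      rw [hτim, hτx, neg_mul, neg_neg, hxi]
    · simp only [hEm, hCi, hAj, hCj, hEp, Submodule.mem_inf, mem_ker_add_id_iff, mem_ker_sub_iff, mem_ker_add_iff,
        mem_ker_sub_id_iff] at hx ⊢
      obtain ⟨⟨hxi, hxj⟩, hτx⟩ := hx
      refine ⟨⟨?_, cen_self hxi⟩, anti_of_cen hij hxj⟩
      rw [hτim, hτx, hxi]
  have f2 : finrank K ↥(Em ⊓ Ai ⊓ Cj) = finrank K ↥(Ci ⊓ Cj ⊓ Ep) := by
    refine finrank_eq_of_mul_mem hb hj (fun x hx => ?_) (fun x hx => ?_)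
    · simp only [hEm, hAi, hCj, hCi, hEp, Submodule.mem_inf, mem_ker_add_id_iff, mem_ker_sub_iff, mem_ker_add_iff,
        mem_ker_sub_id_iff] at hx ⊢
      obtain ⟨⟨hτx, hxi⟩, hxj⟩ := hx
      refine ⟨⟨cen_of_anti hji hxi, cen_self hxj⟩, ?_⟩
      rw [hτjm, hτx, neg_mul, neg_neg, hxj]
    · simp only [hEm, hAi, hCj, hCi, hEp, Submodule.mem_inf, mem_ker_add_id_iff, mem_ker_sub_iff, mem_ker_add_iff,
        mem_ker_sub_id_iff] at hx ⊢
      obtain ⟨⟨hxi, hxj⟩, hτx⟩ := hx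
      refine ⟨⟨?_, anti_of_cen hji hxi⟩, cen_self hxj⟩
      rw [hτjm, hτx, hxj]
  have f3 : finrank K ↥(Em ⊓ Ai ⊓ Aj) = finrank K ↥(Em ⊓ Ai ⊓ Cj) := by
    refine finrank_eq_of_mul_mem ha hi (fun x hx => ?_) (fun x hx => ?_)
    · simp only [hEm, hAi, hAj, hCj, Submodule.mem_inf, mem_ker_add_id_iff, mem_ker_add_iff, mem_ker_sub_iff] at hx ⊢
      obtain ⟨⟨hτx, hxi⟩, hxj⟩ := hx
      refine ⟨⟨?_, anti_self hxi⟩, cen_of_anti hij hxj⟩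
      rw [hτim, hτx, neg_mul, neg_neg, ← neg_neg (x * i), ← hxi]
    · simp only [hEm, hAi, hAj, hCj, Submodule.mem_inf, mem_ker_add_id_iff, mem_ker_add_iff, mem_ker_sub_iff] at hx ⊢
      obtain ⟨⟨hτx, hxi⟩, hxj⟩ := hx
      refine ⟨⟨?_, anti_self hxi⟩, anti_of_cen hij hxj⟩
      rw [hτim, hτx, neg_mul, neg_neg, ← neg_neg (x * i), ← hxi]
  have hm : Em ⊓ Ci ⊓ Cj = Ci ⊓ Cj ⊓ Em := by rw [inf_assoc, inf_comm]
  rw [hm] at hEmCi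
  exact ⟨hC, by omega⟩

/-! ### Statements with the centralizer `C_E(i, j)` -/

/-- **`dim E = 4 · dim C_E(i, j)`** for an anticommuting pair `i² = a`, `j² = b` (`a, b ≠ 0`) in a finite-dimensional
algebra over a field with `2 ≠ 0`. [cite: Voight2021, Prop. 7.7.8 (b)] -/
theorem finrank_eq_four_mul_finrank_centralizer {i j : E} {a b : K} (ha : a ≠ 0) (hb : b ≠ 0)
    (hi : i * i = algebraMap K E a) (hj : j * j = algebraMap K E b) (hij : i * j = -(j * i)) :
    finrank K E = 4 * finrank K ↥(Subalgebra.toSubmodule (Subalgebra.centralizer K ({i, j} : Set E))) := by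
  rw [toSubmodule_centralizer_pair]
  exact finrank_eq_four_mul_finrank_ker ha hb hi hj hij

/-- **`dim C = dim C⁺ + dim C⁻`** (`C = C_E(i,j)`, `C^± = C ∩ ker(τ ∓ 1)`) for a linear anti-involution `τ` with
`τ i = -i`, `τ j = -j`. [cite: Milne1999LefschetzClasses, §2 (type III) and Summary] -/
theorem finrank_centralizer_eq_add {i j : E} {a b : K} (ha : a ≠ 0) (hb : b ≠ 0) (hi : i * i = algebraMap K E a)
    (hj : j * j = algebraMap K E b) (hij : i * j = -(j * i)) (τ : E →ₗ[K] E)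
    (hτm : ∀ x y, τ (x * y) = τ y * τ x) (hττ : ∀ x, τ (τ x) = x) (hτi : τ i = -i) (hτj : τ j = -j) :
    finrank K ↥(Subalgebra.toSubmodule (Subalgebra.centralizer K ({i, j} : Set E))) =
      finrank K ↥(Subalgebra.toSubmodule (Subalgebra.centralizer K ({i, j} : Set E)) ⊓ LinearMap.ker (τ - LinearMap.id)) +
        finrank K ↥(Subalgebra.toSubmodule (Subalgebra.centralizer K ({i, j} : Set E)) ⊓
          LinearMap.ker (τ + LinearMap.id)) := by
  rw [toSubmodule_centralizer_pair]
  exact (finrank_ker_counts ha hb hi hj hij τ hτm hττ hτi hτj).1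

/-- **`dim E⁻ = dim C⁻ + 3 · dim C⁺`**: the skew part `E⁻ = ker(τ + 1)` of a linear anti-involution `τ` with `τ i = -i`,
`τ j = -j` decomposes as `C⁻ ⊕ iC⁺ ⊕ jC⁺ ⊕ ijC⁺` in dimension. [cite: Milne1999LefschetzClasses, §2 (type III) and Summary] -/
theorem finrank_skew_eq_add_three_mul {i j : E} {a b : K} (ha : a ≠ 0) (hb : b ≠ 0) (hi : i * i = algebraMap K E a)
    (hj : j * j = algebraMap K E b) (hij : i * j = -(j * i)) (τ : E →ₗ[K] E)
    (hτm : ∀ x y, τ (x * y) = τ y * τ x) (hττ : ∀ x, τ (τ x) = x) (hτi : τ i = -i) (hτj : τ j = -j) :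
    finrank K ↥(LinearMap.ker (τ + LinearMap.id)) =
      finrank K ↥(Subalgebra.toSubmodule (Subalgebra.centralizer K ({i, j} : Set E)) ⊓ LinearMap.ker (τ + LinearMap.id)) +
        3 * finrank K ↥(Subalgebra.toSubmodule (Subalgebra.centralizer K ({i, j} : Set E)) ⊓
          LinearMap.ker (τ - LinearMap.id)) := by
  rw [toSubmodule_centralizer_pair]
  exact (finrank_ker_counts ha hb hi hj hij τ hτm hττ hτi hτj).2

/-- **`8 · dim C⁻ + 4 · dim E⁻ = 3 · dim E`** — eliminating `dim C` and `dim C⁺` from the three counts.  With `E = End V`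
(`dim E = d²`) and `τ` the adjoint of a symplectic form (`dim E⁻ = d(d+1)/2`) this reads `dim C⁻ = d(d-2)/8`, Milne's
`g²/2 - g/2` for `d = 2g`. [cite: Milne1999LefschetzClasses, §2 (type III) and Summary] [cite: Voight2021, Prop. 7.7.8 (b)] -/
theorem eight_mul_finrank_centralizer_skew_add {i j : E} {a b : K} (ha : a ≠ 0) (hb : b ≠ 0)
    (hi : i * i = algebraMap K E a) (hj : j * j = algebraMap K E b) (hij : i * j = -(j * i)) (τ : E →ₗ[K] E)
    (hτm : ∀ x y, τ (x * y) = τ y * τ x) (hττ : ∀ x, τ (τ x) = x) (hτi : τ i = -i) (hτj : τ j = -j) :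
    8 * finrank K ↥(Subalgebra.toSubmodule (Subalgebra.centralizer K ({i, j} : Set E)) ⊓
        LinearMap.ker (τ + LinearMap.id)) + 4 * finrank K ↥(LinearMap.ker (τ + LinearMap.id)) = 3 * finrank K E := by
  have h1 := finrank_eq_four_mul_finrank_centralizer ha hb hi hj hij
  have h2 := finrank_centralizer_eq_add ha hb hi hj hij τ hτm hττ hτi hτj
  have h3 := finrank_skew_eq_add_three_mul ha hb hi hj hij τ hτm hττ hτi hτj
  omega

end QuaternionCentralizer

end Literature.Algebra.Lie
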